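import Summits.BirchSwinnertonDyer.BirchSwinnertonDyer.Theorems.ManinLocalTwoThreeTameAdditiveTypesAtThree
import Summits.BirchSwinnertonDyer.Rank1Residual.X11b.Three.CornerShapeIstar
import HarnessLib

/-!
# `ord_v(j) = −n` at a place `v ∤ 2` of Kodaira type `Iₙ*` (`n ≥ 1`): the potentially multiplicative tame stratum at `3`, exactly

Summit `BirchSwinnertonDyer`, route `ManinLocalTwoThree` (cell bsd-f2-manin), deciding crux C3 `ManinPrimeToThreeAtNine`
(stmt-BirchSwinnertonDyer-22968).  The tree's `one_lt_valuation_j_of_kodairaSymbolAt_eq_Istar_succ` (`…TateAlgorithmTameTypesOddProofs`)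
proves `ord_v(j) < 0` for type `Iₙ*`, `n ≥ 1`, at `v ∤ 2`; its proof actually computes `v(j) = exp(n)` (i.e. `ord_v j = −n`:
`ord Δ = n + 6`, `ord c₄ = 2` on the integral local minimal model, `j·Δ = c₄³`).  We record the EXACT value and read it over `ℚ`
at `3`, sharpening the classification of p650740 (`…TameAdditiveTypesAtThree`):

* (the exact local value `v(j) = exp(n + 1)` is the tree's `WeierstrassCurve.valuation_j_eq_exp_of_kodairaSymbolAt_eq_Istar_succ`,
  `…X11b.Three.CornerShapeIstar`);
* `padicValRat_three_j_eq_neg_of_kodairaSymbolAt_Istar_succ` — over `ℚ` at `3`: `ord₃ j = −(n + 1)`;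
* `nine_dvd_conductorNorm_classification` — `9 ∥ N` ⟹ `III` (`ord₃ Δ_min = 3`), `I₀*` (`6`), `III*` (`9`), or `Iₙ*` with
  `ord₃ Δ_min = n + 6` AND `ord₃ j = −n` (`n ≥ 1`): on the tame cell at `3` the type is read off `(ord₃ Δ_min, ord₃ j)`.

HONEST FRAMING: local structure; C3, Manin's conjecture and BSD are not proved.  No definitions, no named facts, no sorry.
References: [SilvermanATAEC1994] IV.9.4 Step 7, Table 4.1, IV.11.1.
-/

set_option linter.dupNamespace false
set_option autoImplicit false

noncomputable section

open scoped Classical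

open WeierstrassCurve IsDedekindDomain IsLocalRing Polynomial
  Literature.NumberTheory.DiophantineGeometry Literature.NumberTheory.DiophantineGeometry.TateAlgorithm
  Literature.NumberTheory.EllipticCurves
open IsDiscreteValuationRing hiding maximalIdeal

namespace Summit.BirchSwinnertonDyer.BirchSwinnertonDyer.Theorems.ManinLocalTwoThree


section Rat

open NumberField Rat.HeightOneSpectrum Summit.BirchSwinnertonDyer.Rank1Residual.Additive

/-- **Over `ℚ` at `3`: type `Iₙ*` (`n ≥ 1`) has `ord₃ j = −n`** (stated for `Istar (n + 1)`: `padicValRat 3 j = −(n + 1)`).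
[cite: SilvermanATAEC1994, IV.9.4 Step 7 and Table 4.1] -/
theorem padicValRat_three_j_eq_neg_of_kodairaSymbolAt_Istar_succ (W : WeierstrassCurve ℚ) [W.IsElliptic] {n : ℕ}
    (hT : W.kodairaSymbolAt (placeOf 3) = .Istar (n + 1)) : padicValRat 3 W.j = -((n : ℤ) + 1) := by
  haveI : PerfectField (IsLocalRing.ResidueField ((placeOf 3).adicCompletionIntegers ℚ)) := PerfectField.ofFinite
  have h2 : ringChar (ℤ ⧸ (placeOf 3).asIdeal) ≠ 2 := by rw [ringChar_int_quot_placeOf 3]; decide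
  have h := W.valuation_j_eq_exp_of_kodairaSymbolAt_eq_Istar_succ (placeOf 3) h2 hT
  have hgen : natGenerator (placeOf 3) = 3 :=
    congrArg Subtype.val ((primesEquiv (R := ℤ)).apply_symm_apply ⟨3, Nat.prime_three⟩)
  have hj0 : W.j ≠ 0 := by
    intro hj0
    rw [hj0, map_zero] at h
    exact WithZero.exp_ne_zero h.symm
  rw [valuation_eq_exp_neg_padicValRat (placeOf 3) hj0, hgen] at h
  have := WithZero.exp_injective h
  omega

/-- **The tame cell at `3`, exactly** (`W` globally minimal, `9 ∥ N`): `III` with `ord₃ Δ_min = 3`; `I₀*` with `6`; `III*` with `9`; or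
`Iₙ*` (`n ≥ 1`) with `ord₃ Δ_min = n + 6` and `ord₃ j = −n` — so on the tame cell the Kodaira type at `3` is READ OFF `ord₃ Δ_min`
and the sign of `ord₃ j`. [cite: SilvermanATAEC1994, IV.9.4 Table 4.1 and IV.11.1] -/
theorem nine_dvd_conductorNorm_classification (W : WeierstrassCurve ℚ) [W.IsElliptic] [W.IsGloballyMinimal]
    (h9 : 3 ^ 2 ∣ W.conductorNorm ℤ) (h27 : ¬ 3 ^ 3 ∣ W.conductorNorm ℤ) :
    (W.kodairaSymbolAt (placeOf 3) = .III ∧ padicValInt 3 W.minimalDiscriminantInt = 3) ∨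
      (W.kodairaSymbolAt (placeOf 3) = .Istar 0 ∧ padicValInt 3 W.minimalDiscriminantInt = 6) ∨
      (W.kodairaSymbolAt (placeOf 3) = .IIIstar ∧ padicValInt 3 W.minimalDiscriminantInt = 9) ∨
      ∃ n, W.kodairaSymbolAt (placeOf 3) = .Istar (n + 1) ∧ padicValInt 3 W.minimalDiscriminantInt = n + 7 ∧
        padicValRat 3 W.j = -((n : ℤ) + 1) := by
  rcases padicValInt_three_minimalDiscriminantInt_of_nine_dvd_conductorNorm W h9 h27 with h | h | h | ⟨n, hT, hd, -⟩
  · exact Or.inl h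
  · exact Or.inr (Or.inl h)
  · exact Or.inr (Or.inr (Or.inl h))
  · exact Or.inr (Or.inr (Or.inr ⟨n, hT, hd, padicValRat_three_j_eq_neg_of_kodairaSymbolAt_Istar_succ W hT⟩))

end Rat

end Summit.BirchSwinnertonDyer.BirchSwinnertonDyer.Theorems.ManinLocalTwoThree

end
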